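import Summits.BirchSwinnertonDyer.BirchSwinnertonDyer.Theses.ByReductionTypeAtTwo
import Summits.BirchSwinnertonDyer.Rank1Residual.F1Sign2.DescentSignAtTwo
import Summits.BirchSwinnertonDyer.Rank1Residual.F1Sign2.HeegnerEggAtTwo
import Summits.BirchSwinnertonDyer.Rank1Residual.F1Sign2.TranspositionDoorAtTwo
import Summits.BirchSwinnertonDyer.Rank1Residual.F1Sign2.TranspositionSupplyAtTwo
import Summits.BirchSwinnertonDyer.Rank1Residual.F1Sign2.TwistSelmerRelaxedAtInfinityAtTwo
import Literature.NumberTheory.EllipticCurves.HeegnerPoints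
import Literature.NumberTheory.EllipticCurves.HeegnerPointsRationalityProofs
import HarnessLib

/-!
# LINE «egg-kolyvagin-two» v6 = «three doors» — skeleton for crux `RankOneAtTwoBigImageOddLocal`
# (item stmt-BirchSwinnertonDyer-23715, child of 19099 `RankOneAtTwo`, route ByReductionTypeAtTwo; cell bsd-f1-sign2, seat -an g9;
# v5 = tree commit of `Lines/egg_kolyvagin_two.lean` sha16 358ce4e11d6dff8a, `HOME/MEMO-an-data/g8/`)

The crux: BSD₂ for every non-CM `E/ℚ` of analytic rank `1` with `ρ_{E,2^n}` onto for every `n`, `#E(ℚ)_tors` odd and `∏ c_ℓ` odd.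
Idea (MEMO-an §2 AN-13 / AN-22K / AN-24 / AN-26): read the 2-part of BSD through the tree door `P2.bsdp_two_iff_of_heegner_rankOne`
for a MINIMALLY RAMIFIED Heegner field `K = ℚ(√d)` whose ramified places `v` with `E(ℚ_v)[2] ≠ 0` («doors») are as few as the sign
allows, so that the Heegner index `I_K` has the SMALLEST possible 2-valuation and that valuation is DECIDED by printed twist-Selmer laws:
* `Δ > 0`, `E(ℚ) ⊄ E⁰(ℝ)` (`ε = +1`, egg locus): ONE door, at `∞` (-desc `DescAdmissible`; Kramer 1981 Prop 6): `I_K` odd (v4);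
* `Δ < 0`: ONE door, at a transposition prime `q₀` chosen open by Chebotarev (tree `SingleDoor.TranspositionSupplyAtTwo`): `I_K` odd (v5);
* `Δ > 0`, `E(ℚ) ⊂ E⁰(ℝ)` (`ε = −1`; NEW in v6 — v5's residual): the door at `∞` is shut and a Heegner `d ≡ 1 (8)` carries an EVEN
  number of transposition primes (AN-22J), so the minimum is TWO finite doors `q₀, q₁` (`T = {∞, q₀, q₁}`, Mazur–Rubin 2010 §3).
  The new object is the ∞-relaxed Selmer group `R = Sel₂^{rel ∞}(E) = ⟨δP₀, c_∞⟩` (tree `selmerGroupRelaxedAtInfinityAtTwo`; `c_∞` =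
  the everywhere-finitely-soluble, really-insoluble `2`-covering, present iff `ε = −1`).  T-2q (theorem on paper: MR 2010 Prop 3.3 +
  Poonen–Rains 2012 Thm 4.14 + Klagsbrun–Mazur–Rubin 2013): with a door open, `Sel₂(E^{(d)}) = 0 ⟺ R` misses the twisted conditions
  above `q₀, q₁ ⟺ p_{q₀} b_{q₁} + p_{q₁} b_{q₀} = 1` (`p` = door bits of `δP₀`, `b` = local bits of `c_∞`); MR Lemma 3.5 + Chebotarev
  SUPPLY such `(d, q₀, q₁)` with `Sel₂(E^{(d)}) = 0` for every curve of the locus; and the door then reads `BSD₂(E) ⟺ v₂ I_K = 1`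
  EXACTLY (`n_∞ = 2`, `w_K = 2`, `v₂ q_d = v₂ ∏c_ℓ + 2` from the two `I₀*` primes) — AN-26, the `ε = −1` twin of Kolyvagin-at-2 in
  door form.  Census ENGINE J (kit j298065, N < 6·10⁴: 5 293 curves with `ε = −1`, Ш_an odd; 212 929 two-transposition twists; pre-registered
  P26.1–5): MR bound 0/212 929 violations; ONE bit vector `b` per curve explains `Sel₂`-triviality of EVERY twist (5 293/5 293 systems
  consistent, 176 403 redundant predictions met, 0 failed; second engine = rank-2 twin's points 3 043/3 043); every slice curve has a
  `Sel₂`-trivial pair (1 339/1 339); Sel-trivial ⇒ `r_an(E^{(d)}) = 0`, `Ш_an(E^{(d)})` odd (1 591/1 591), `v₂ Tam(E^{(d)}) = v₂ Tam(E) + 2`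
  (3 794/3 794).  ENGINE K (kit j298313 = ENGINE F helpers verbatim, 60 slice rows): `v₂ I_K = 1` on 46/46 certified rows
  (`I_K ∈ {2, 6, 10, 18, 22, 30, 78}`, all `≡ 2 mod 4`), 0 violations.
So v6's residual on the slice is `Ш(E)[2] ≠ 0` ALONE (`stub_shaTwoOnSlice`; other lenses: -desc tower floor, -imc, -es fkl).

v6 diff against v5 (statement level; for -ref1): (a) imports `F1Sign2.TranspositionSupplyAtTwo` (d9c4b7362ae301f4) and
`F1Sign2.TwistSelmerRelaxedAtInfinityAtTwo`; the local `OnNegLocus` is DELETED in favour of the tree's byte-identical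
`SingleDoor.OnNegLocus`, and `S_supplyNeg` is RE-POINTED to the tree Prop `SingleDoor.TranspositionSupplyAtTwo` (+ the odd-Manin half
`S_manin`, stated once); (b) NEW locus `OnIdLocus` and the two-door carriers `TwoTranspAdmissible`, `twistCondAbove` and Props
`TwoTranspositionTwistLawAtTwo` (T-2q), `TwoTranspositionSupplyAtTwo`, `TwoTranspositionIndexLawAtTwo` (AN-26) — VERBATIM copies of
`HOME/MEMO-an-data/g9/Sketch_v15.lean` (cf92bd0e…; to be re-pointed to `F1Sign2/TwoTranspositionDoorAtTwo.lean` once -ty ports it);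
(c) `S_twistSelmer`, `S_kolyvaginTwo`, `S_twistValue`, `S_supply` each gain a third conjunct `…Id` for the `ε = −1` locus (the `Pos`/`Neg`
conjuncts are v5 VERBATIM); (d) `S_door` delivers `S_egg ∧ S_neg ∧ S_id`; (e) residual `S_offDoorsOnSlice` ↦ `S_shaTwoOnSlice`
(`¬ ShaTwoTrivial W` is now the ONLY negated hypothesis); (f) certificate `s_kolyvaginTwo_of_tree` gains the binder
`TwoTranspositionIndexLawAtTwo`; (g) composition by `ShaTwoTrivial`, then the sign of `Δ` (`Δ ≠ 0` from `IsElliptic`), then `MeetsEgg`.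
Still SEVEN sorried stubs + kernel-checked helpers, certificate and composition; nothing is asserted.  BSD is not proved by any of this.
The card `Lines/egg-kolyvagin-two.md` v5 l.90 sentence «Δ > 0, ε = −1 via two transposition primes: dead by MR» was an over-reading
of MR Prop 3.3 (`#T = 3` bounds `dim Sel₂(E^{(d)}) ≤ 2`, it does not force `≥ 2`) and is withdrawn in card v6.
-/

noncomputable section

open scoped Classical

namespace Summit.BirchSwinnertonDyer.BirchSwinnertonDyer.Cruxes.RankOneAtTwoBigImageOddLocal.EggKolyvaginTwo

open Literature.NumberTheory.EllipticCurves Literature.NumberTheory.EllipticCurves.ModularForms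
  Summit.BirchSwinnertonDyer.Rank1Residual.F1Sign2
  Summit.BirchSwinnertonDyer.Rank1Residual.F1Sign2.TranspositionDoor
  Summit.BirchSwinnertonDyer.Rank1Residual.F1Sign2.SingleDoor
  NumberField IsDedekindDomain

set_option autoImplicit false
set_option linter.dupNamespace false

/-- The egg locus with odd Tamagawa product (door at `∞`; v3/v4/v5 verbatim). -/
def OnEggLocus (W : WeierstrassCurve ℚ) [W.IsElliptic] : Prop :=
  0 < W.Δ ∧ NoRationalTwoTorsion W ∧ ShaTwoTrivial W ∧ MeetsEgg W ∧ ¬ 2 ∣ W.tamagawaProduct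

/-  v5's local `OnNegLocus` is now the tree's `SingleDoor.OnNegLocus` (byte-identical body
    `W.Δ < 0 ∧ NoRationalTwoTorsion W ∧ ShaTwoTrivial W ∧ ¬ 2 ∣ W.tamagawaProduct`). -/

/-- NEW in v6: the identity-component locus with odd Tamagawa product (`ε = −1`: `Δ > 0`, `E(ℚ)[2] = 0`, `Ш(E)[2] = 0`,
`E(ℚ) ⊂ E⁰(ℝ)`, `∏ c_ℓ` odd) — v5's residual, now served by the two-transposition door. -/
def OnIdLocus (W : WeierstrassCurve ℚ) [W.IsElliptic] : Prop :=
  0 < W.Δ ∧ NoRationalTwoTorsion W ∧ ShaTwoTrivial W ∧ ¬ MeetsEgg W ∧ ¬ 2 ∣ W.tamagawaProduct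

/-- HELPER (proved, v4 verbatim): odd `#E(ℚ)_tors` ⇒ the `2`-division cubic has no rational root. -/
theorem noRationalTwoTorsion_of_odd_torsionOrder (W : WeierstrassCurve ℚ) [W.IsElliptic]
    (hodd : Odd W.torsionOrder) : NoRationalTwoTorsion W := by
  intro x hx
  obtain ⟨y, hxy, hy⟩ := hx
  have hns : W.toAffine.Nonsingular x y := WeierstrassCurve.Affine.equation_iff_nonsingular.1 hxy
  set P : W.toAffine.Point := WeierstrassCurve.Affine.Point.some x y hns with hPdef
  have hP2 : 2 • P = 0 := by
    rw [two_nsmul, hPdef]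
    exact WeierstrassCurve.Affine.Point.add_self_of_Y_eq (by
      rw [WeierstrassCurve.Affine.negY]; linear_combination hy)
  have hPne : P ≠ 0 := WeierstrassCurve.Affine.Point.some_ne_zero hns
  have hPtors : P ∈ AddCommGroup.torsion W.toAffine.Point := by
    rw [AddCommGroup.mem_torsion, isOfFinAddOrder_iff_nsmul_eq_zero]
    exact ⟨2, by norm_num, hP2⟩
  have hord : addOrderOf P = 2 := by
    haveI : Fact (Nat.Prime 2) := ⟨Nat.prime_two⟩
    exact addOrderOf_eq_prime hP2 hPne
  have hdvd : 2 ∣ W.torsionOrder := by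
    have h := (AddCommGroup.torsion W.toAffine.Point).addOrderOf_dvd_natCard hPtors
    rw [hord] at h
    unfold WeierstrassCurve.torsionOrder
    convert h
  exact (Nat.not_even_iff_odd.mpr hodd) (even_iff_two_dvd.mpr hdvd)

/-- HELPER (proved, v4 verbatim): on the slice the three-conjunct egg condition is the five-conjunct `OnEggLocus`. -/
theorem onEggLocus_of_slice (W : WeierstrassCurve ℚ) [W.IsElliptic]
    (hT : Odd W.torsionOrder) (hc : Odd W.tamagawaProduct)
    (h : 0 < W.Δ ∧ ShaTwoTrivial W ∧ MeetsEgg W) : OnEggLocus W :=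
  ⟨h.1, noRationalTwoTorsion_of_odd_torsionOrder W hT, h.2.1, h.2.2,
    fun h2 => (Nat.not_even_iff_odd.mpr hc) (even_iff_two_dvd.mpr h2)⟩

/-- HELPER (proved): on the slice the two-conjunct `Δ < 0` condition is the four-conjunct `OnNegLocus`. -/
theorem onNegLocus_of_slice (W : WeierstrassCurve ℚ) [W.IsElliptic]
    (hT : Odd W.torsionOrder) (hc : Odd W.tamagawaProduct)
    (h : W.Δ < 0 ∧ ShaTwoTrivial W) : OnNegLocus W :=
  ⟨h.1, noRationalTwoTorsion_of_odd_torsionOrder W hT, h.2,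
    fun h2 => (Nat.not_even_iff_odd.mpr hc) (even_iff_two_dvd.mpr h2)⟩

/-- S1 PUBLISHED (v3/v4 verbatim): Gross–Zagier, Kolyvagin, `K`-rationality of the complex Heegner point for every
parametrisation datum (`heegnerPointComplex_mem_range_map`, a tree theorem), GZK over `ℚ`, modularity (tree named facts). -/
def S_pub : Prop :=
  (∀ (N : ℕ) [NeZero N] (W : WeierstrassCurve ℚ) (K : Type) [Field K] [NumberField K],
      gross_zagier N W K ∧ kolyvagin N W K ∧ heegnerPointComplex_mem_range_map N W K) ∧
    rank_eq_analyticRank_of_analyticRank_le_one ∧ WeierstrassCurve.hasEntireLFunction_rat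

/-- The `K`-rationality conjunct of `S_pub` is a tree theorem (Darmon 2004, Thm 3.6). -/
theorem pub_heegner_rationality (N : ℕ) [NeZero N] (W : WeierstrassCurve ℚ) (K : Type) [Field K] [NumberField K] :
    heegnerPointComplex_mem_range_map N W K :=
  heegnerPointComplex_mem_range_map_holds N W K

/-! ### The two-transposition door (carriers and Props = `Sketch_v15.lean` verbatim, namespace-local until -ty ports them) -/

/-- Two-transposition-admissible Heegner twist parameter at `Δ > 0` (Sketch v15): `d < 0` squarefree, `d ≡ 1 (mod 8)`;
`q₀ ≠ q₁` primes dividing `d`, good, with Frobenius a transposition on `W[2]` (`(Δ_min/q) = −1`); every other `q ∣ d` good with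
`a_q` odd; `d` a square modulo every odd bad prime. [cite: MazurRubin2010, Def 3.1 and Prop 3.3] -/
def TwoTranspAdmissible (W : WeierstrassCurve ℚ) [W.IsGloballyMinimal] (d : ℤ) (q₀ q₁ : ℕ) : Prop :=
  d < 0 ∧ Squarefree d ∧ d % 8 = 1 ∧ q₀.Prime ∧ q₁.Prime ∧ q₀ ≠ q₁ ∧ (q₀ : ℤ) ∣ d ∧ (q₁ : ℤ) ∣ d ∧
    jacobiSym W.Δ.num q₀ = -1 ∧ jacobiSym W.Δ.num q₁ = -1 ∧
    (∀ q : ℕ, q.Prime → (q : ℤ) ∣ d →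
      (∀ _h : Fact q.Prime, W.HasGoodReductionAtPrime q) ∧ (q ≠ q₀ → q ≠ q₁ → Odd (W.frobeniusTrace q))) ∧
    (∀ ℓ : ℕ, ℓ.Prime → ℓ ≠ 2 → (∀ _h : Fact ℓ.Prime, ¬ W.HasGoodReductionAtPrime ℓ) → jacobiSym d ℓ = 1)

/-- The twisted `2`-Selmer local condition above the rational prime `q`, read on `H¹(ℚ, W[2])` (tree `PrimeTwist.selmerLocalKer`). -/
def twistCondAbove (W : WeierstrassCurve ℚ) (χ : Field.absoluteGaloisGroup ℚ →ₜ* Multiplicative (ZMod 2)) (q : ℕ) :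
    AddSubgroup (W.galH1Torsion ((2 : ℕ) : ℤ)) :=
  ⨅ (v : HeightOneSpectrum (𝓞 ℚ)) (_ : ((q : ℤ) : 𝓞 ℚ) ∈ v.asIdeal), PrimeTwist.selmerLocalKer W χ (v.adicCompletion ℚ)

/-- T-2q `TwoTranspositionTwistLawAtTwo` (THEOREM on paper: Mazur–Rubin 2010 Lemma 3.2 / Prop 3.3 at `T = {∞, q₀, q₁}` +
Poonen–Rains 2012 Thm 4.14 / Prop 4.11 (quadratic form; load-bearing) + Klagsbrun–Mazur–Rubin 2013 (twisted conditions Lagrangian)).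
A door open at `q₀` or `q₁`: `#Sel₂(W^{(d)}) ∈ {1, 4}` and `Sel₂(W^{(d)}) = 0` iff no non-zero class of the ∞-relaxed Selmer group
of `W` satisfies the twisted conditions above `q₀` and `q₁`; both doors closed: `#Sel₂(W^{(d)}) ∈ {4, 16}`.
[cite: MazurRubin2010, Lemma 3.2 and Prop 3.3] [cite: PoonenRains2012, Thm 4.14 and Prop 4.11] [cite: KlagsbrunMazurRubin2013, §3] -/
def TwoTranspositionTwistLawAtTwo : Prop :=
  ∀ (W : WeierstrassCurve ℚ) [W.IsElliptic] [W.IsGloballyMinimal] [W.IsIntegral ℤ], 0 < W.Δ → NoRationalTwoTorsion W →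
    W.mordellWeilRank = 1 → ShaTwoTrivial W → ¬ MeetsEgg W →
    ∀ (d : ℤ) (q₀ q₁ : ℕ) [Fact q₀.Prime] [Fact q₁.Prime] (χ : Field.absoluteGaloisGroup ℚ →ₜ* Multiplicative (ZMod 2)),
      TwoTranspAdmissible W d q₀ q₁ → IsQuadraticCharacterOf χ d →
      ((MeetsNonNormAt W q₀ ∨ MeetsNonNormAt W q₁) →
          (twistSelmerTwoCard W d = 1 ∨ twistSelmerTwoCard W d = 4) ∧
          (twistSelmerTwoCard W d = 1 ↔
            selmerGroupRelaxedAtInfinityAtTwo W ⊓ twistCondAbove W χ q₀ ⊓ twistCondAbove W χ q₁ = ⊥)) ∧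
      (¬ MeetsNonNormAt W q₀ → ¬ MeetsNonNormAt W q₁ → twistSelmerTwoCard W d = 4 ∨ twistSelmerTwoCard W d = 16)

/-- `TwoTranspositionSupplyAtTwo` (THEOREM on paper: Mazur–Rubin 2010 Lemma 3.5 + Chebotarev + T-2q): on the rank-one `ε = −1`
locus there are an imaginary quadratic `K`, `(d_K, N) = 1`, Heegner hypothesis, and transposition primes `q₀ ≠ q₁ ∣ d_K` with
`(d_K, q₀, q₁)` two-transposition-admissible and `Sel₂(W^{(d_K)}) = 0`. [cite: MazurRubin2010, Lemma 3.5 and Prop 3.3] -/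
def TwoTranspositionSupplyAtTwo : Prop :=
  ∀ (W : WeierstrassCurve ℚ) [W.IsElliptic] [W.IsGloballyMinimal] [NeZero (W.conductorNorm ℤ)],
    0 < W.Δ → NoRationalTwoTorsion W → W.mordellWeilRank = 1 → ShaTwoTrivial W → ¬ MeetsEgg W →
    ∃ (K : Type) (_ : Field K) (_ : NumberField K) (q₀ q₁ : ℕ),
      IsImaginaryQuadratic K ∧ TwoTranspAdmissible W (NumberField.discr K) q₀ q₁ ∧
      twistSelmerTwoCard W (NumberField.discr K) = 1 ∧
      Nat.Coprime (NumberField.discr K).natAbs (W.conductorNorm ℤ) ∧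
      SatisfiesHeegnerHypothesis (W.conductorNorm ℤ) K

/-- AN-26 `TwoTranspositionIndexLawAtTwo` (CONJECTURE of the lens at `ε = −1`, Sketch v15; BSD₂-shadow through the P2 door with
`n_∞ = 2`, `k = 1`, `w_K = 2`, `v₂ q_d = v₂ ∏c_ℓ + 2`): for `K` two-transposition-admissible with `Sel₂(E^{(d_K)}) = 0` and an
odd-constant parametrisation, the Heegner point is TWICE a point that is NOT twice, up to torsion (`v₂ I_K = 1` exactly).
[cite: GrossLMS1991, Conj. 1.2 and §3] [cite: Kramer1981, Thm. 1] [cite: MazurRubin2010, Prop 3.3] -/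
def TwoTranspositionIndexLawAtTwo : Prop :=
  ∀ (W : WeierstrassCurve ℚ) [W.IsElliptic] [W.IsGloballyMinimal] [NeZero (W.conductorNorm ℤ)],
    W.mordellWeilRank = 1 → 0 < W.Δ → NoRationalTwoTorsion W → ShaTwoTrivial W → ¬ MeetsEgg W →
    ¬ 2 ∣ W.tamagawaProduct →
    ∀ (q₀ q₁ : ℕ) (K : Type) [Field K] [NumberField K], IsImaginaryQuadratic K →
      TwoTranspAdmissible W (NumberField.discr K) q₀ q₁ → twistSelmerTwoCard W (NumberField.discr K) = 1 →
      ∀ (Dt : ModularParametrizationData W (W.conductorNorm ℤ))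
        (H : HeegnerDatum (W.conductorNorm ℤ) (NumberField.discr K)) (ι : K →+* ℂ)
        (P : (W.baseChange K).toAffine.Point),
        WeierstrassCurve.Affine.Point.map ι.toRatAlgHom P = heegnerPointComplex Dt H →
        ¬ (2 : ℤ) ∣ Dt.c →
        ∃ Q : (W.baseChange K).toAffine.Point,
          P - 2 • Q ∈ AddCommGroup.torsion (W.baseChange K).toAffine.Point ∧ NotTwiceUpToTorsion W K Q

/-- HELPER (proved): on the slice the three-conjunct `ε = −1` condition is the five-conjunct `OnIdLocus`. -/
theorem onIdLocus_of_slice (W : WeierstrassCurve ℚ) [W.IsElliptic]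
    (hT : Odd W.torsionOrder) (hc : Odd W.tamagawaProduct)
    (hΔ : 0 < W.Δ) (hS : ShaTwoTrivial W) (hε : ¬ MeetsEgg W) : OnIdLocus W :=
  ⟨hΔ, noRationalTwoTorsion_of_odd_torsionOrder W hT, hS, hε,
    fun h2 => (Nat.not_even_iff_odd.mpr hc) (even_iff_two_dvd.mpr h2)⟩

/-- S2 PRINTED TWIST-SELMER LAWS, three doors (tree Props by name + T-2q): -desc THEOREM A `AdmissibleTwistSelmerShiftAtTwo` and T-C
`EggTwistLawAtTwo` (Kramer 1981 Prop. 6; door at `∞`), T-q₀ `TranspositionTwistLawAtTwo` (Mazur–Rubin 2010 Prop. 3.3 at `T = {q₀}` +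
Kramer 1981 Prop. 3; door at `q₀`), and NEW in v6 T-2q `TwoTranspositionTwistLawAtTwo` (doors at `q₀, q₁`; `T = {∞, q₀, q₁}`).
[cite: Kramer1981, Prop. 3 and Prop. 6] [cite: MazurRubin2010, Prop. 3.3] [cite: PoonenRains2012, Thm 4.14] -/
def S_twistSelmer : Prop :=
  AdmissibleTwistSelmerShiftAtTwo ∧ EggTwistLawAtTwo ∧ TranspositionTwistLawAtTwo ∧ TwoTranspositionTwistLawAtTwo

/-- S3⁺ (v4 `S_kolyvaginTwo` verbatim): Kolyvagin's conjecture at `2` under big image, DOOR AT `∞` (egg locus). -/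
def S_kolyvaginTwoPos : Prop :=
  ∀ (W : WeierstrassCurve ℚ) [W.IsElliptic] [W.IsGloballyMinimal] [NeZero (W.conductorNorm ℤ)],
    (∀ n : ℕ, W.HasSurjectiveModNGaloisRep ((2 ^ n : ℕ) : ℤ)) → W.analyticRank = 1 → OnEggLocus W →
    ∀ (K : Type) [Field K] [NumberField K], IsImaginaryQuadratic K →
      DescAdmissible W (NumberField.discr K) →
      ∀ (Dt : ModularParametrizationData W (W.conductorNorm ℤ))
        (H : HeegnerDatum (W.conductorNorm ℤ) (NumberField.discr K)) (ι : K →+* ℂ)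
        (P : (W.baseChange K).toAffine.Point),
        WeierstrassCurve.Affine.Point.map ι.toRatAlgHom P = heegnerPointComplex Dt H →
        ¬ (2 : ℤ) ∣ Dt.c → NotTwiceUpToTorsion W K P

/-- S3⁻ (NEW in v5): Kolyvagin's conjecture at `2` under big image, DOOR AT A TRANSPOSITION PRIME (`Δ < 0`): for `ρ_{W,2^n}`
onto, analytic rank one, `W` on the transposition locus at `q₀` (`Δ < 0`, `E(ℚ)[2] = 0`, `Ш[2] = 0`, door open at `q₀`,
`∏ c_ℓ` odd), `K` imaginary quadratic with `(d_K, q₀)` transposition-admissible, a parametrisation datum with ODD constant and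
`P ∈ E(K)` mapping to its complex Heegner point: `P ∉ 2E(K) + E(K)_tors`.  = the (⟸) half of the tree conjecture AN-22K
`TranspositionDoorLawAtTwo` with the big-image binder added and `mordellWeilRank = 1` traded for `analyticRank = 1`.  Census
ENGINE H j296119: 421/421 (door open ⇒ `I_K` odd), image-unrestricted.  Why it might fail: as AN-22K (no Kolyvagin-system
structure theorem at `2`; `a_{q₀}` even at the door prime, outside every printed `2`-divisibility criterion).
[cite: GrossLMS1991, Conj. 1.2 and §3] [cite: Zhang2014CJM, Thm 1.1] [cite: KrizLi2019, Lemma 5.4, Rem. 1.14] -/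
def S_kolyvaginTwoNeg : Prop :=
  ∀ (W : WeierstrassCurve ℚ) [W.IsElliptic] [W.IsGloballyMinimal] [NeZero (W.conductorNorm ℤ)],
    (∀ n : ℕ, W.HasSurjectiveModNGaloisRep ((2 ^ n : ℕ) : ℤ)) → W.analyticRank = 1 →
    ∀ (q₀ : ℕ) [Fact q₀.Prime], OnTranspLocus W q₀ →
    ∀ (K : Type) [Field K] [NumberField K], IsImaginaryQuadratic K →
      TranspAdmissible W (NumberField.discr K) q₀ →
      ∀ (Dt : ModularParametrizationData W (W.conductorNorm ℤ))
        (H : HeegnerDatum (W.conductorNorm ℤ) (NumberField.discr K)) (ι : K →+* ℂ)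
        (P : (W.baseChange K).toAffine.Point),
        WeierstrassCurve.Affine.Point.map ι.toRatAlgHom P = heegnerPointComplex Dt H →
        ¬ (2 : ℤ) ∣ Dt.c → NotTwiceUpToTorsion W K P


/-- S3ᶦᵈ (NEW in v6): Kolyvagin at `2` under big image, TWO TRANSPOSITION DOORS (`ε = −1`): for `ρ_{W,2^n}` onto, analytic rank
one, `W` on the identity-component locus, `K` imaginary quadratic with `(d_K, q₀, q₁)` two-transposition-admissible and
`Sel₂(W^{(d_K)}) = 0`, a parametrisation datum with ODD constant and `P ∈ E(K)` mapping to its complex Heegner point: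
`P ∈ 2E(K) + tors` and its half is not — `v₂ I_K = 1`.  = AN-26 `TwoTranspositionIndexLawAtTwo` with the big-image binder added
and `mordellWeilRank = 1` traded for `analyticRank = 1`.  Why it might fail: as AN-26 (2-part of BSD at `ε = −1`; no Kolyvagin-system
structure theorem at `2`; two additive primes in the Gross–Zagier bookkeeping).  Census ENGINE J tranche V + ENGINE H ask P26.4.
[cite: GrossLMS1991, Conj. 1.2 and §3] [cite: Kramer1981, Thm. 1] [cite: MazurRubin2010, Prop 3.3 and Lemma 3.5] -/
def S_kolyvaginTwoId : Prop :=
  ∀ (W : WeierstrassCurve ℚ) [W.IsElliptic] [W.IsGloballyMinimal] [NeZero (W.conductorNorm ℤ)],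
    (∀ n : ℕ, W.HasSurjectiveModNGaloisRep ((2 ^ n : ℕ) : ℤ)) → W.analyticRank = 1 → OnIdLocus W →
    ∀ (q₀ q₁ : ℕ) (K : Type) [Field K] [NumberField K], IsImaginaryQuadratic K →
      TwoTranspAdmissible W (NumberField.discr K) q₀ q₁ → twistSelmerTwoCard W (NumberField.discr K) = 1 →
      ∀ (Dt : ModularParametrizationData W (W.conductorNorm ℤ))
        (H : HeegnerDatum (W.conductorNorm ℤ) (NumberField.discr K)) (ι : K →+* ℂ)
        (P : (W.baseChange K).toAffine.Point),
        WeierstrassCurve.Affine.Point.map ι.toRatAlgHom P = heegnerPointComplex Dt H →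
        ¬ (2 : ℤ) ∣ Dt.c →
        ∃ Q : (W.baseChange K).toAffine.Point,
          P - 2 • Q ∈ AddCommGroup.torsion (W.baseChange K).toAffine.Point ∧ NotTwiceUpToTorsion W K Q

/-- S3 KOLYVAGIN AT 2 IN DOOR FORM (HARDEST): three doors. -/
def S_kolyvaginTwo : Prop := S_kolyvaginTwoPos ∧ S_kolyvaginTwoNeg ∧ S_kolyvaginTwoId

/-- CERTIFICATE (proved): the stub is implied by GZK (published), the tree's two conjectures of record AN-13′
`HeegnerKummerClassNonzeroAtTwo` (door at `∞`) and AN-22K `TranspositionDoorLawAtTwo` (door at `q₀`), and AN-26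
`TwoTranspositionIndexLawAtTwo` (doors at `q₀, q₁`; Sketch v15) — the child's version only ADDS the big-image binder and trades
`mordellWeilRank = 1` for `analyticRank = 1`. -/
theorem s_kolyvaginTwo_of_tree (hGZK : rank_eq_analyticRank_of_analyticRank_le_one)
    (h13 : HeegnerKummerClassNonzeroAtTwo) (h22 : TranspositionDoorLawAtTwo) (h26 : TwoTranspositionIndexLawAtTwo) :
    S_kolyvaginTwo := by
  refine ⟨?_, ?_, ?_⟩
  · intro W _ _ _ _hbig hr hEgg K _ _ hK hAdm Dt H ι P hP hc
    have hrk : W.mordellWeilRank = 1 := by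
      have h := (hGZK W (by rw [hr])).1
      rw [h, hr]
    exact h13 W hEgg.1 hEgg.2.1 hrk hEgg.2.2.1 hEgg.2.2.2.1 hEgg.2.2.2.2 K hK hAdm Dt H ι P hP hc
  · intro W _ _ _ _hbig hr q₀ _ hloc K _ _ hK hAdm Dt H ι P hP hc
    have hrk : W.mordellWeilRank = 1 := by
      have h := (hGZK W (by rw [hr])).1
      rw [h, hr]
    exact notTwice_of_doorLaw h22 W hrk q₀ hloc K hK hAdm Dt H ι P hP hc
  · intro W _ _ _ _hbig hr hId q₀ q₁ K _ _ hK hAdm hSel Dt H ι P hP hc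
    have hrk : W.mordellWeilRank = 1 := by
      have h := (hGZK W (by rw [hr])).1
      rw [h, hr]
    exact h26 W hrk hId.1 hId.2.1 hId.2.2.1 hId.2.2.2.1 hId.2.2.2.2 q₀ q₁ K hK hAdm hSel Dt H ι P hP hc

/-- S4⁺ (v4 `S_twistValue` verbatim): 2-part of BSD for the rank-0, `Sel₂`-trivial DESCENT-admissible twist (door at `∞` open),
in the door's currency `q_d = L(E^{(d)},1)/Ω(E^{(d)}_min)`: `v₂ q_d = v₂ ∏ c_ℓ(E)` (every `q ∣ d` has `a_q` odd, `c_q(E^{(d)}) = 1`).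
[cite: Zhai2016, Thm 1.1] [cite: KrizLi2019, Thm 5.1] -/
def S_twistValuePos : Prop :=
  ∀ (W : WeierstrassCurve ℚ) [W.IsElliptic] [W.IsGloballyMinimal],
    (∀ n : ℕ, W.HasSurjectiveModNGaloisRep ((2 ^ n : ℕ) : ℤ)) → W.analyticRank = 1 → OnEggLocus W →
    ∀ d : ℤ, DescAdmissible W d →
      ∀ (Wd : WeierstrassCurve ℚ) [Wd.IsElliptic] [Wd.IsGloballyMinimal] (Cd : WeierstrassCurve.VariableChange ℚ),
        Cd • W.quadraticTwist (d : ℚ) = Wd →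
        ∃ qd : ℚ, Wd.entireLFunction 1 / (Wd.realPeriodRat : ℂ) = (qd : ℂ) ∧
          qd ≠ 0 ∧ padicValRat 2 qd = padicValNat 2 W.tamagawaProduct

/-- S4⁻ (NEW in v5): 2-part of BSD for the rank-0, `Sel₂`-trivial TRANSPOSITION-admissible twist (door at `q₀` open, so
`Sel₂(E^{(d)}) = 0` by T-q₀): `v₂ q_d = v₂ ∏ c_ℓ(E) + 1` — the twist acquires `c_{q₀}(E^{(d)}) = 2` (type `I₀*`, one rational
root of the `2`-division cubic mod `q₀`) and `c_q(E^{(d)}) = 1` at the other `q ∣ d`; `Ш(E^{(d)})[2] = 0`, `E^{(d)}(ℚ)[2] = 0`.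
OPEN IN PRINT at a transposition prime (`a_{q₀}` even: outside Zhai 2016 / Kriz–Li 2019 / Cai–Li–Zhai 2020).  Census P-22
(j296119): `v₂ Ш_an(E^{(d)}) = 0` on all 421 open-door rows, i.e. `v₂(L(E^{(d)},1)/Ω) = v₂ Tam(E^{(d)}) = 1` there.
[cite: Zhai2016, Thm 1.1] [cite: KrizLi2019, Thm 5.1] [cite: JetchevSkinnerWan2017, §7.4.1] -/
def S_twistValueNeg : Prop :=
  ∀ (W : WeierstrassCurve ℚ) [W.IsElliptic] [W.IsGloballyMinimal],
    (∀ n : ℕ, W.HasSurjectiveModNGaloisRep ((2 ^ n : ℕ) : ℤ)) → W.analyticRank = 1 →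
    ∀ (q₀ : ℕ) [Fact q₀.Prime], OnTranspLocus W q₀ →
    ∀ d : ℤ, TranspAdmissible W d q₀ →
      ∀ (Wd : WeierstrassCurve ℚ) [Wd.IsElliptic] [Wd.IsGloballyMinimal] (Cd : WeierstrassCurve.VariableChange ℚ),
        Cd • W.quadraticTwist (d : ℚ) = Wd →
        ∃ qd : ℚ, Wd.entireLFunction 1 / (Wd.realPeriodRat : ℂ) = (qd : ℂ) ∧
          qd ≠ 0 ∧ padicValRat 2 qd = padicValNat 2 W.tamagawaProduct + 1


/-- S4ᶦᵈ (NEW in v6): 2-part of BSD for the rank-0, `Sel₂`-trivial TWO-TRANSPOSITION-admissible twist (`ε = −1` locus):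
`v₂ q_d = v₂ ∏ c_ℓ(E) + 2` — the twist acquires `c_{q₀}(E^{(d)}) = c_{q₁}(E^{(d)}) = 2` (type `I₀*`, one rational root each) and
`c_q = 1` at the other `q ∣ d`; `Ш(E^{(d)})[2] = 0`, `E^{(d)}(ℚ)[2] = 0`.  OPEN IN PRINT (two additive primes with `a_q` even).
Census ENGINE J tranche V: `Ш_an(E^{(d)}) = 1` and `v₂ Tam(E^{(d)}) = v₂ Tam(E) + 2` on every Sel-trivial row.
[cite: Zhai2016, Thm 1.1] [cite: KrizLi2019, Thm 5.1] [cite: CaiLiZhai2020, Thm 1.1] -/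
def S_twistValueId : Prop :=
  ∀ (W : WeierstrassCurve ℚ) [W.IsElliptic] [W.IsGloballyMinimal],
    (∀ n : ℕ, W.HasSurjectiveModNGaloisRep ((2 ^ n : ℕ) : ℤ)) → W.analyticRank = 1 → OnIdLocus W →
    ∀ (d : ℤ) (q₀ q₁ : ℕ), TwoTranspAdmissible W d q₀ q₁ → twistSelmerTwoCard W d = 1 →
      ∀ (Wd : WeierstrassCurve ℚ) [Wd.IsElliptic] [Wd.IsGloballyMinimal] (Cd : WeierstrassCurve.VariableChange ℚ),
        Cd • W.quadraticTwist (d : ℚ) = Wd →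
        ∃ qd : ℚ, Wd.entireLFunction 1 / (Wd.realPeriodRat : ℂ) = (qd : ℂ) ∧
          qd ≠ 0 ∧ padicValRat 2 qd = padicValNat 2 W.tamagawaProduct + 2

/-- S4 TWIST VALUE, three doors. -/
def S_twistValue : Prop := S_twistValuePos ∧ S_twistValueNeg ∧ S_twistValueId

/-- S5⁺ (v4 `S_supply` verbatim): an admissible imaginary quadratic `K` with `(d_K, N) = 1` satisfying the Heegner hypothesis,
and a parametrisation datum with odd constant (Manin parity: theorem for `4 ∤ N`, OPEN for `4 ∣ N` — REF1 §42).
[cite: arXiv:1703.02951, Thm. 1.2] -/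
def S_supplyPos : Prop :=
  ∀ (W : WeierstrassCurve ℚ) [W.IsElliptic] [W.IsGloballyMinimal] [NeZero (W.conductorNorm ℤ)],
    OnEggLocus W →
    (∃ (K : Type) (_ : Field K) (_ : NumberField K),
        IsImaginaryQuadratic K ∧ DescAdmissible W (NumberField.discr K) ∧
        Nat.Coprime (NumberField.discr K).natAbs (W.conductorNorm ℤ) ∧
        SatisfiesHeegnerHypothesis (W.conductorNorm ℤ) K) ∧
    ∃ Dt : ModularParametrizationData W (W.conductorNorm ℤ), ¬ (2 : ℤ) ∣ Dt.c


/-- Odd Manin-type constant: on the `E(ℚ)[2] = 0` locus (no rational `2`-isogeny, so every parametrisation constant in the isogeny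
class has the parity of the optimal one) some parametrisation datum has ODD constant (theorem for `4 ∤ N`, OPEN for `4 ∣ N` —
REF1 §42; v5 carried this inside `S_supplyPos`/`S_supplyNeg`, v6 states it once). [cite: arXiv:1703.02951, Thm. 1.2] -/
def S_manin : Prop :=
  ∀ (W : WeierstrassCurve ℚ) [W.IsElliptic] [W.IsGloballyMinimal] [NeZero (W.conductorNorm ℤ)],
    NoRationalTwoTorsion W → ∃ Dt : ModularParametrizationData W (W.conductorNorm ℤ), ¬ (2 : ℤ) ∣ Dt.c

/-- S5 SUPPLY, three doors: S5⁺ (v4 verbatim), S5⁻ RE-POINTED in v6 to the TREE Prop `SingleDoor.TranspositionSupplyAtTwo`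
(`F1Sign2/TranspositionSupplyAtTwo.lean` d9c4b7362ae301f4 — AN-24S, THEOREM on paper: Chebotarev in the `S₄`-field `ℚ(½P₀)`),
S5ᶦᵈ NEW `TwoTranspositionSupplyAtTwo` (MR 2010 Lemma 3.5 + Chebotarev + T-2q), and the odd-constant half `S_manin`.
[cite: Kramer1981, Prop. 3] [cite: MazurRubin2010, Lemma 3.5] [cite: arXiv:1703.02951, Thm. 1.2] -/
def S_supply : Prop := S_supplyPos ∧ TranspositionSupplyAtTwo ∧ TwoTranspositionSupplyAtTwo ∧ S_manin

/-- The egg-locus half of the child (v4 verbatim). -/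
def S_egg : Prop :=
  ∀ (W : WeierstrassCurve ℚ) [W.IsElliptic] [W.IsGloballyMinimal],
    ¬ W.HasCM → (∀ n : ℕ, W.HasSurjectiveModNGaloisRep ((2 ^ n : ℕ) : ℤ)) → W.analyticRank = 1 → OnEggLocus W → BSDp W 2

/-- The `Δ < 0` half of the child (NEW in v5). -/
def S_neg : Prop :=
  ∀ (W : WeierstrassCurve ℚ) [W.IsElliptic] [W.IsGloballyMinimal],
    ¬ W.HasCM → (∀ n : ℕ, W.HasSurjectiveModNGaloisRep ((2 ^ n : ℕ) : ℤ)) → W.analyticRank = 1 → OnNegLocus W → BSDp W 2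


/-- The `ε = −1` third of the child (NEW in v6). -/
def S_id : Prop :=
  ∀ (W : WeierstrassCurve ℚ) [W.IsElliptic] [W.IsGloballyMinimal],
    ¬ W.HasCM → (∀ n : ℕ, W.HasSurjectiveModNGaloisRep ((2 ^ n : ℕ) : ℤ)) → W.analyticRank = 1 → OnIdLocus W → BSDp W 2

/-- S6 GLUE (M-sized Lean over the tree's P2 door `bsdp_two_iff_of_heegner_rankOne`), three doors.  Bookkeeping ledger
`v₂(8 I² t_W² / (n k² t_K² c² w² q_d |u| c_W)) = v₂ #Ш(W) = 0`: door at `∞` (v4: `n = 2`, `k = 1`, `w² = 4`, `v₂ q_d = v₂ c_W`, `I` odd);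
door at `q₀` (v5: `n = 1`, `v₂ q_d = v₂ c_W + 1`, `I` odd); doors at `q₀, q₁` (v6: `n = 2`, `k = 1` since `E(K)[2] = 0`, `w² = 4`,
`v₂ q_d = v₂ c_W + 2` by S4ᶦᵈ, and `v₂ I = 1` by S3ᶦᵈ: `3 + 2 − (1 + 0 + 0 + 0 + 2 + (v₂ c_W + 2) + 0 + v₂ c_W) = 0` with `c_W` odd).
`|u| = 1` is the PROVED tree theorem `WeierstrassCurve.u_eq_one_or_eq_neg_one_of_smul_quadraticTwist_of_squarefree`; `K`, `q₀`,
`q₁`, `Dt` come from S5, `P` from S1's rationality, `H` from `nonempty_heegnerDatum_holds` / `exists_dvd_sq_sub_discr_holds`;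
`W.IsIntegral ℤ` from `IsGloballyMinimal`. [cite: Pal2012, Prop. 2.5 and Cor. 2.6] [cite: GrossZagier1986, V.§2] -/
def S_door : Prop := S_pub → S_twistSelmer → S_kolyvaginTwo → S_twistValue → S_supply → S_egg ∧ S_neg ∧ S_id

/-- S7 RESIDUAL ON THE SLICE (no plan in this line; v6: SMALLER than v5's): big 2-adic image, odd torsion, odd Tamagawa, analytic
rank one and `Ш(E)[2] ≠ 0` — every such curve is off all three door loci (each needs `Ш[2] = 0` for the printed twist-Selmer law to
decide the door).  Other lenses bear on it (-desc tower floor: Cassels–Tate / mod-4 control, -imc aligned transport, -es fkl). -/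
def S_shaTwoOnSlice : Prop :=
  ∀ (W : WeierstrassCurve ℚ) [W.IsElliptic] [W.IsGloballyMinimal],
    ¬ W.HasCM → (∀ n : ℕ, W.HasSurjectiveModNGaloisRep ((2 ^ n : ℕ) : ℤ)) → Odd W.torsionOrder → Odd W.tamagawaProduct →
    W.analyticRank = 1 → ¬ ShaTwoTrivial W → BSDp W 2

theorem stub_pub : S_pub := by sorry
theorem stub_twistSelmer : S_twistSelmer := by sorry
theorem stub_kolyvaginTwo : S_kolyvaginTwo := by sorry
theorem stub_twistValue : S_twistValue := by sorry
theorem stub_supply : S_supply := by sorry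
theorem stub_door : S_door := by sorry
theorem stub_shaTwoOnSlice : S_shaTwoOnSlice := by sorry

/-- Kernel-checked composition: the seven stubs give the child crux BY NAME — by cases on `Ш[2] = 0`, then on the sign of `Δ`
(`Δ ≠ 0` for an elliptic curve), then on the egg bit; the slice binders `Odd torsionOrder` / `Odd tamagawaProduct` upgrade the
case hypotheses to `OnEggLocus` / `OnNegLocus` / `OnIdLocus` via the proved helpers. -/
theorem RankOneAtTwoBigImageOddLocal_of :
    S_pub → S_twistSelmer → S_kolyvaginTwo → S_twistValue → S_supply → S_door → S_shaTwoOnSlice →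
      Summit.BirchSwinnertonDyer.BirchSwinnertonDyer.Theses.ByReductionTypeAtTwo.RankOneAtTwoBigImageOddLocal := by
  intro h1 h2 h3 h4 h5 h6 h7 W _ _ hCM hsurj hT hc hr
  by_cases hS : ShaTwoTrivial W
  · have hΔ0 : W.Δ ≠ 0 := W.isUnit_Δ.ne_zero
    rcases lt_trichotomy W.Δ 0 with hneg | hzero | hpos
    · exact (h6 h1 h2 h3 h4 h5).2.1 W hCM hsurj hr (onNegLocus_of_slice W hT hc ⟨hneg, hS⟩)
    · exact absurd hzero hΔ0
    · by_cases hE : MeetsEgg W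
      · exact (h6 h1 h2 h3 h4 h5).1 W hCM hsurj hr (onEggLocus_of_slice W hT hc ⟨hpos, hS, hE⟩)
      · exact (h6 h1 h2 h3 h4 h5).2.2 W hCM hsurj hr (onIdLocus_of_slice W hT hc hpos hS hE)
  · exact h7 W hCM hsurj hT hc hr hS

theorem RankOneAtTwoBigImageOddLocal_holds :
    Summit.BirchSwinnertonDyer.BirchSwinnertonDyer.Theses.ByReductionTypeAtTwo.RankOneAtTwoBigImageOddLocal :=
  RankOneAtTwoBigImageOddLocal_of stub_pub stub_twistSelmer stub_kolyvaginTwo stub_twistValue stub_supply stub_door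
    stub_shaTwoOnSlice

end Summit.BirchSwinnertonDyer.BirchSwinnertonDyer.Cruxes.RankOneAtTwoBigImageOddLocal.EggKolyvaginTwo

end
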